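import Summits.NavierStokesRegularity.NavierStokesRegularity.Theses.RecurrentProfiles
import Literature.Analysis.FluidPDE.AncientLimitVanishingScaled

/-!
# Route RecurrentProfiles — item `RecurrentRegularIsTrivial` (stmt-NavierStokesRegularity-1592)

`recurrentRegularIsTrivial_proof : RecurrentRegularIsTrivial` — the two conclusions of the
recurrent Liouville theorem agree: a field `u` on the backward slab `ℝ³ × (−∞, 0)`, locally
integrable, UNIFORMLY RECURRENT under the Navier–Stokes scaling `σ ↦ u_σ = nsRescale (e^σ) u` in
`L³_loc(ℝ³ × (−∞, 0])`, and REGULAR at the space–time origin (`(0,0)` is not a backward singular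
point, i.e. `u ∈ L^∞(Q((0,0), r))` for some `r > 0`) vanishes a.e. on the slab.

Proof (the planner's five lines, made quantitative without Minkowski's inequality so that no
measurability of the rescaled field is needed): `‖u‖ ≤ N` a.e. on `Q(0, r)`; for a compact
`K ⊆ {t ≤ 0}` and `c = e^σ` small, the parabolic dilation `(t, x) ↦ (c² t, c x)` maps `K ∩ {t < 0}`
into `Q(0, r)` and is quasi-measure-preserving, so `‖u_σ‖ ≤ c N` a.e. on `K`; pointwise
`‖u‖³ ≤ (‖u_σ − u‖ + c N)³ ≤ 4 (‖u_σ − u‖³ + (c N)³)`, whence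
`∫_K ‖u‖³ ≤ 4 ‖u_σ − u‖³_{L³(K)} + 4 (c N)³ |K| ≤ 4 ε³ (1 + |K|)` once recurrence supplies
`σ ≤ log θ` with `‖u_σ − u‖_{L³(K)} ≤ ε`; `ε → 0` gives `∫_K ‖u‖³ = 0`, and the slab is a countable
union of such `K`.

## References

* H. Furstenberg, *Recurrence in Ergodic Theory and Combinatorial Number Theory* (1981), §1.4
  (uniform recurrence). [Furstenberg1981]
* D. Albritton, T. Barker, arXiv:1811.00502, §1 (backward singular points). [AlbrittonBarker2019]
-/

noncomputable section

-- `Summit.<Summit>.<Problem>.Theorems` repeats the name of this single-problem summit (D-0017).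
set_option linter.dupNamespace false

namespace Summit.NavierStokesRegularity.NavierStokesRegularity.Theorems

open MeasureTheory Set Function Filter Topology Metric
open Literature.Analysis.FluidPDE
open scoped NNReal ENNReal

/-- **Cubes without Minkowski.** If `‖g‖ ≤ δ` a.e., then
`∫ ‖f‖³ ≤ 4 ∫ ‖g − f‖³ + 4 δ³ μ(univ)` — from `‖f‖ ≤ ‖g − f‖ + ‖g‖` and
`(a + b)³ ≤ 4 (a³ + b³)`; no measurability of `f` or `g` is required. [folklore] -/
theorem lintegral_enorm_rpow_three_le_of_ae_le {α : Type*} [MeasurableSpace α] {μ : Measure α}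
    {F : Type*} [NormedAddCommGroup F] (f g : α → F) {δ : ℝ≥0∞} (hg : ∀ᵐ z ∂μ, ‖g z‖ₑ ≤ δ) :
    ∫⁻ z, ‖f z‖ₑ ^ (3 : ℝ) ∂μ ≤
      4 * ∫⁻ z, ‖g z - f z‖ₑ ^ (3 : ℝ) ∂μ + 4 * (δ ^ (3 : ℝ) * μ univ) := by
  have h4 : (2 : ℝ≥0∞) ^ ((3 : ℝ) - 1) = 4 := by
    rw [show (3 : ℝ) - 1 = 2 by norm_num, ENNReal.rpow_two]; norm_num
  have hpt : ∀ᵐ z ∂μ, ‖f z‖ₑ ^ (3 : ℝ) ≤ 4 * ‖g z - f z‖ₑ ^ (3 : ℝ) + 4 * δ ^ (3 : ℝ) := by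
    filter_upwards [hg] with z hz
    have h1 : ‖f z‖ₑ ≤ ‖g z - f z‖ₑ + ‖g z‖ₑ := by
      calc ‖f z‖ₑ = ‖g z - (g z - f z)‖ₑ := by rw [sub_sub_cancel]
        _ ≤ ‖g z‖ₑ + ‖g z - f z‖ₑ := enorm_sub_le
        _ = ‖g z - f z‖ₑ + ‖g z‖ₑ := add_comm _ _
    have h2 : ‖f z‖ₑ ≤ ‖g z - f z‖ₑ + δ := h1.trans (add_le_add_right hz _)
    calc ‖f z‖ₑ ^ (3 : ℝ) ≤ (‖g z - f z‖ₑ + δ) ^ (3 : ℝ) :=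
          ENNReal.rpow_le_rpow h2 (by norm_num)
      _ ≤ (2 : ℝ≥0∞) ^ ((3 : ℝ) - 1) * (‖g z - f z‖ₑ ^ (3 : ℝ) + δ ^ (3 : ℝ)) :=
          ENNReal.rpow_add_le_mul_rpow_add_rpow _ _ (by norm_num)
      _ = 4 * ‖g z - f z‖ₑ ^ (3 : ℝ) + 4 * δ ^ (3 : ℝ) := by rw [h4, mul_add]
  calc ∫⁻ z, ‖f z‖ₑ ^ (3 : ℝ) ∂μ
      ≤ ∫⁻ z, (4 * ‖g z - f z‖ₑ ^ (3 : ℝ) + 4 * δ ^ (3 : ℝ)) ∂μ := lintegral_mono_ae hpt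
    _ = ∫⁻ z, 4 * ‖g z - f z‖ₑ ^ (3 : ℝ) ∂μ + ∫⁻ _z, 4 * δ ^ (3 : ℝ) ∂μ :=
        lintegral_add_right _ measurable_const
    _ = 4 * ∫⁻ z, ‖g z - f z‖ₑ ^ (3 : ℝ) ∂μ + 4 * (δ ^ (3 : ℝ) * μ univ) := by
        rw [lintegral_const_mul' _ _ (by norm_num), lintegral_const, mul_assoc]

/-- From `‖f‖_{L³(μ)} ≤ t` to `∫ ‖f‖³ dμ ≤ t³`. [folklore] -/
theorem lintegral_enorm_rpow_three_le_of_eLpNorm_le {α : Type*} [MeasurableSpace α]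
    {μ : Measure α} {F : Type*} [NormedAddCommGroup F] {f : α → F} {t : ℝ≥0∞}
    (h : eLpNorm f 3 μ ≤ t) : ∫⁻ z, ‖f z‖ₑ ^ (3 : ℝ) ∂μ ≤ t ^ (3 : ℝ) := by
  rw [eLpNorm_eq_lintegral_rpow_enorm_toReal (by norm_num) (by simp), ENNReal.toReal_ofNat] at h
  have h' := ENNReal.rpow_le_rpow h (show (0 : ℝ) ≤ 3 by norm_num)
  rwa [← ENNReal.rpow_mul, show 1 / (3 : ℝ) * 3 = 1 by norm_num, ENNReal.rpow_one] at h'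

/-- **Regular at the origin ⇒ essentially bounded near it**: if `(0, 0)` is not a backward
singular point of `u` then `‖u‖ ≤ N` a.e. on some backward parabolic ball `Q((0,0), r)`,
`r > 0` (unfolding Albritton–Barker's definition). [cite: AlbrittonBarker2019, §1] -/
theorem exists_ae_enorm_le_of_not_isBackwardSingularPoint
    {u : ℝ → EuclideanSpace ℝ (Fin 3) → EuclideanSpace ℝ (Fin 3)}
    (h : ¬ IsBackwardSingularPoint u 0) :
    ∃ r : ℝ, 0 < r ∧ ∃ N : ℝ≥0, ∀ᵐ w ∂(volume : Measure (ℝ × EuclideanSpace ℝ (Fin 3))),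
      w ∈ parabolicCylinder r (0 : ℝ × EuclideanSpace ℝ (Fin 3)) → ‖uncurry u w‖ₑ ≤ N := by
  simp only [IsBackwardSingularPoint, not_forall] at h
  obtain ⟨r, hr, hne⟩ := h
  refine ⟨r, hr, ?_⟩
  have hae : ∀ᵐ w ∂(volume.restrict (parabolicCylinder r (0 : ℝ × EuclideanSpace ℝ (Fin 3)))),
      ‖uncurry u w‖ₑ ≤
        eLpNorm (uncurry u) ∞
          (volume.restrict (parabolicCylinder r (0 : ℝ × EuclideanSpace ℝ (Fin 3)))) := by
    rw [eLpNorm_exponent_top]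
    exact ae_le_eLpNormEssSup
  refine ⟨(eLpNorm (uncurry u) ∞
    (volume.restrict (parabolicCylinder r (0 : ℝ × EuclideanSpace ℝ (Fin 3))))).toNNReal, ?_⟩
  rw [ENNReal.coe_toNNReal hne]
  exact (ae_restrict_iff' (isOpen_parabolicCylinder r _).measurableSet).1 hae

/-- **The rescaled field is small on `K`.** If `‖u‖ ≤ N` a.e. on `Q((0,0), r)`, `K ⊆ {t ≤ 0}` is
measurable with `|t|, ‖x‖ ≤ M` on `K`, and `0 < c` with `c M < r`, `c² M < r²`, then
`‖(nsRescale c u)(t, x)‖ = c ‖u(c² t, c x)‖ ≤ c N` for a.e. `(t, x) ∈ K`: the parabolic dilation is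
quasi-measure-preserving (`quasiMeasurePreserving_parabolicDilation`) and maps `K ∩ {t < 0}` into
`Q((0,0), r)`, while `{t = 0}` is null. [folklore] -/
theorem ae_restrict_enorm_nsRescale_le
    {u : ℝ → EuclideanSpace ℝ (Fin 3) → EuclideanSpace ℝ (Fin 3)} {r : ℝ} {N : ℝ≥0}
    (hN : ∀ᵐ w ∂(volume : Measure (ℝ × EuclideanSpace ℝ (Fin 3))),
      w ∈ parabolicCylinder r (0 : ℝ × EuclideanSpace ℝ (Fin 3)) → ‖uncurry u w‖ₑ ≤ N)
    {K : Set (ℝ × EuclideanSpace ℝ (Fin 3))} (hKm : MeasurableSet K)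
    (hKsub : K ⊆ Iic (0 : ℝ) ×ˢ univ) {M : ℝ} (hM : ∀ z ∈ K, |z.1| ≤ M ∧ ‖z.2‖ ≤ M)
    {c : ℝ} (hc : 0 < c) (hcM : c * M < r) (hc2M : c ^ 2 * M < r ^ 2) :
    ∀ᵐ z ∂(volume.restrict K), ‖nsRescale c u z.1 z.2‖ₑ ≤ ENNReal.ofReal c * N := by
  have h0 : ∀ᵐ z ∂(volume : Measure (ℝ × EuclideanSpace ℝ (Fin 3))), z.1 ≠ 0 := by
    rw [ae_iff]
    have hset : {z : ℝ × EuclideanSpace ℝ (Fin 3) | ¬ z.1 ≠ 0} =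
        ({0} : Set ℝ) ×ˢ (univ : Set (EuclideanSpace ℝ (Fin 3))) := by
      ext z; simp
    rw [hset, Measure.volume_eq_prod, Measure.prod_prod, Real.volume_singleton, zero_mul]
  have h1 := (quasiMeasurePreserving_parabolicDilation hc.ne').ae hN
  rw [ae_restrict_iff' hKm]
  filter_upwards [h0, h1] with z hz0 hz1 hzK
  have hzle : z.1 ≤ 0 := (hKsub hzK).1
  have hz1' : z.1 < 0 := lt_of_le_of_ne hzle hz0
  obtain ⟨hzt, hzx⟩ := hM z hzK
  have hmem : (c ^ 2 * z.1, c • z.2) ∈ parabolicCylinder r (0 : ℝ × EuclideanSpace ℝ (Fin 3)) := by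
    rw [mem_parabolicCylinder]
    refine ⟨⟨?_, ?_⟩, ?_⟩
    · simp only [Prod.fst_zero, zero_sub]
      have hzt' : -M ≤ z.1 := (abs_le.1 hzt).1
      nlinarith [sq_nonneg c, mul_le_mul_of_nonneg_left hzt' (sq_nonneg c)]
    · simp only [Prod.fst_zero]
      exact mul_neg_of_pos_of_neg (pow_pos hc 2) hz1'
    · simp only [Prod.snd_zero, dist_zero_right, norm_smul, Real.norm_eq_abs, abs_of_pos hc]
      calc c * ‖z.2‖ ≤ c * M := mul_le_mul_of_nonneg_left hzx hc.le
        _ < r := hcM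
  have hb : ‖u (c ^ 2 * z.1) (c • z.2)‖ₑ ≤ N := hz1 hmem
  rw [nsRescale_apply, enorm_smul, Real.enorm_eq_ofReal hc.le]
  exact mul_le_mul_right hb _

/-- **`∫_K ‖u‖³ = 0` on every compact `K ⊆ {t ≤ 0}`** for a uniformly recurrent field bounded by
`N` a.e. on `Q((0,0), r)`: choose `c = e^σ ≤ θ` by recurrence (windows `[a, a + L]` with
`a = log θ − L`), bound `∫_K ‖u‖³ ≤ 4 ε³ + 4 ε³ |K|` by the two lemmas above, and let `ε → 0`.
[folklore] -/
theorem lintegral_enorm_rpow_three_eq_zero_of_recurrent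
    {u : ℝ → EuclideanSpace ℝ (Fin 3) → EuclideanSpace ℝ (Fin 3)} {r : ℝ} (hr : 0 < r) {N : ℝ≥0}
    (hN : ∀ᵐ w ∂(volume : Measure (ℝ × EuclideanSpace ℝ (Fin 3))),
      w ∈ parabolicCylinder r (0 : ℝ × EuclideanSpace ℝ (Fin 3)) → ‖uncurry u w‖ₑ ≤ N)
    (hrec : ∀ ε : ℝ, 0 < ε → ∀ K : Set (ℝ × EuclideanSpace ℝ (Fin 3)), IsCompact K →
      K ⊆ Set.Iic (0 : ℝ) ×ˢ Set.univ → ∃ L : ℝ, 0 < L ∧ ∀ a : ℝ, ∃ σ ∈ Set.Icc a (a + L),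
        eLpNorm (fun z : ℝ × EuclideanSpace ℝ (Fin 3) =>
          nsRescale (Real.exp σ) u z.1 z.2 - u z.1 z.2) 3 (volume.restrict K) ≤ ENNReal.ofReal ε)
    {K : Set (ℝ × EuclideanSpace ℝ (Fin 3))} (hKc : IsCompact K)
    (hKsub : K ⊆ Iic (0 : ℝ) ×ˢ univ) :
    ∫⁻ z in K, ‖uncurry u z‖ₑ ^ (3 : ℝ) = 0 := by
  -- a common bound `M ≥ 1` for `|t|` and `‖x‖` on `K`
  obtain ⟨C, hC⟩ := hKc.isBounded.exists_norm_le
  set M : ℝ := max C 1 with hM_def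
  have hM1 : 1 ≤ M := le_max_right _ _
  have hM0 : 0 < M := lt_of_lt_of_le one_pos hM1
  have hM : ∀ z ∈ K, |z.1| ≤ M ∧ ‖z.2‖ ≤ M := fun z hz =>
    ⟨(Real.norm_eq_abs z.1 ▸ norm_fst_le z).trans ((hC z hz).trans (le_max_left _ _)),
      (norm_snd_le z).trans ((hC z hz).trans (le_max_left _ _))⟩
  have hKfin : volume K ≠ ∞ := hKc.measure_lt_top.ne
  -- the bound for every `ε > 0`
  have hbound : ∀ ε : ℝ, 0 < ε → ∫⁻ z in K, ‖uncurry u z‖ₑ ^ (3 : ℝ) ≤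
      4 * ENNReal.ofReal ε ^ (3 : ℝ) + 4 * (ENNReal.ofReal ε ^ (3 : ℝ) * volume K) := by
    intro ε hε
    obtain ⟨L, hL, hwin⟩ := hrec ε hε K hKc hKsub
    set n : ℝ := (N : ℝ) with hn_def
    have hn0 : 0 ≤ n := N.coe_nonneg
    set θ : ℝ := min (r / (2 * M)) (ε / (n + 1)) with hθ_def
    have hθpos : 0 < θ := lt_min (by positivity) (by positivity)
    obtain ⟨σ, hσ, hσε⟩ := hwin (Real.log θ - L)
    set c : ℝ := Real.exp σ with hc_def
    have hc : 0 < c := Real.exp_pos σ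
    have hcθ : c ≤ θ := by
      have hσ' : σ ≤ Real.log θ := by linarith [hσ.2]
      calc c = Real.exp σ := rfl
        _ ≤ Real.exp (Real.log θ) := Real.exp_le_exp.2 hσ'
        _ = θ := Real.exp_log hθpos
    have hθM : θ * M < r := by
      calc θ * M ≤ r / (2 * M) * M := mul_le_mul_of_nonneg_right (min_le_left _ _) hM0.le
        _ = r / 2 := by field_simp
        _ < r := by linarith
    have hcM : c * M < r := lt_of_le_of_lt (mul_le_mul_of_nonneg_right hcθ hM0.le) hθM
    have hc2M : c ^ 2 * M < r ^ 2 := by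
      have hcM0 : 0 ≤ c * M := mul_nonneg hc.le hM0.le
      have hsq : (c * M) ^ 2 < r ^ 2 := pow_lt_pow_left₀ hcM hcM0 two_ne_zero
      calc c ^ 2 * M ≤ c ^ 2 * M * M := le_mul_of_one_le_right (by positivity) hM1
        _ = (c * M) ^ 2 := by ring
        _ < r ^ 2 := hsq
    have hcn : c * n ≤ ε := by
      calc c * n ≤ θ * n := mul_le_mul_of_nonneg_right hcθ hn0
        _ ≤ ε / (n + 1) * n := mul_le_mul_of_nonneg_right (min_le_right _ _) hn0
        _ = ε * (n / (n + 1)) := by ring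
        _ ≤ ε * 1 := mul_le_mul_of_nonneg_left ((div_le_one (by positivity)).2 (by linarith)) hε.le
        _ = ε := mul_one ε
    have hδ : ENNReal.ofReal c * (N : ℝ≥0∞) ≤ ENNReal.ofReal ε := by
      rw [← ENNReal.ofReal_coe_nnreal, ← ENNReal.ofReal_mul hc.le]
      exact ENNReal.ofReal_le_ofReal hcn
    have hg : ∀ᵐ z ∂(volume.restrict K), ‖nsRescale c u z.1 z.2‖ₑ ≤ ENNReal.ofReal c * N :=
      ae_restrict_enorm_nsRescale_le hN hKc.isClosed.measurableSet hKsub hM hc hcM hc2M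
    have hA := lintegral_enorm_rpow_three_le_of_ae_le (μ := volume.restrict K) (uncurry u)
      (fun z => nsRescale c u z.1 z.2) hg
    have hB : ∫⁻ z in K, ‖nsRescale c u z.1 z.2 - uncurry u z‖ₑ ^ (3 : ℝ) ≤
        ENNReal.ofReal ε ^ (3 : ℝ) :=
      lintegral_enorm_rpow_three_le_of_eLpNorm_le hσε
    have hδ3 : (ENNReal.ofReal c * N) ^ (3 : ℝ) ≤ ENNReal.ofReal ε ^ (3 : ℝ) :=
      ENNReal.rpow_le_rpow hδ (by norm_num)
    calc ∫⁻ z in K, ‖uncurry u z‖ₑ ^ (3 : ℝ)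
        ≤ (4 * ∫⁻ z in K, ‖nsRescale c u z.1 z.2 - uncurry u z‖ₑ ^ (3 : ℝ)) +
            4 * ((ENNReal.ofReal c * N) ^ (3 : ℝ) * (volume.restrict K) univ) := hA
      _ ≤ 4 * ENNReal.ofReal ε ^ (3 : ℝ) + 4 * (ENNReal.ofReal ε ^ (3 : ℝ) * volume K) := by
        rw [Measure.restrict_apply_univ]
        exact add_le_add (mul_le_mul_right hB 4) (mul_le_mul_right (mul_le_mul_left hδ3 _) 4)
  -- let `ε → 0`
  set g : ℝ≥0∞ → ℝ≥0∞ := fun t => 4 * t ^ (3 : ℝ) + 4 * (t ^ (3 : ℝ) * volume K) with hg_def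
  have hgc : Continuous g := by
    have h3 : Continuous fun t : ℝ≥0∞ => t ^ (3 : ℝ) := ENNReal.continuous_rpow_const
    exact ((ENNReal.continuous_const_mul (by norm_num)).comp h3).add
      ((ENNReal.continuous_const_mul (by norm_num)).comp
        ((ENNReal.continuous_mul_const hKfin).comp h3))
  have hg0 : g 0 = 0 := by
    simp [hg_def]
  have hgt : Tendsto (fun ε : ℝ => g (ENNReal.ofReal ε)) (𝓝[>] 0) (𝓝 0) := by
    have h := (hgc.comp ENNReal.continuous_ofReal).tendsto 0
    rw [Function.comp_apply, ENNReal.ofReal_zero, hg0] at h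
    exact tendsto_nhdsWithin_of_tendsto_nhds h
  have hev : ∀ᶠ ε in 𝓝[>] (0 : ℝ), ∫⁻ z in K, ‖uncurry u z‖ₑ ^ (3 : ℝ) ≤ g (ENNReal.ofReal ε) := by
    filter_upwards [self_mem_nhdsWithin] with ε hε
    exact hbound ε hε
  exact le_antisymm (ge_of_tendsto hgt hev) (zero_le)

/-- **`RecurrentRegularIsTrivial` (item stmt-NavierStokesRegularity-1592).** A locally integrable
field on the slab `ℝ³ × (−∞, 0)` that is uniformly recurrent under the Navier–Stokes scaling in
`L³_loc(ℝ³ × (−∞, 0])` and regular at the space–time origin vanishes a.e. on the slab: by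
`lintegral_enorm_rpow_three_eq_zero_of_recurrent`, `∫_K ‖u‖³ = 0` on each of the compact sets
`K_n = [−(n+1), −1/(n+1)] × B̄(0, n+1) ⊆ {t < 0}`, which exhaust the slab, and `u` is a.e.
strongly measurable there. [folklore] -/
theorem recurrentRegularIsTrivial_proof :
    Summit.NavierStokesRegularity.NavierStokesRegularity.Theses.RecurrentProfiles.RecurrentRegularIsTrivial := by
  unfold Summit.NavierStokesRegularity.NavierStokesRegularity.Theses.RecurrentProfiles.RecurrentRegularIsTrivial
  intro u hloc hrec hreg
  obtain ⟨r, hr, N, hN⟩ := exists_ae_enorm_le_of_not_isBackwardSingularPoint hreg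
  have hmeas : AEStronglyMeasurable (uncurry u) (volume.restrict (Iio (0 : ℝ) ×ˢ univ)) :=
    hloc.aestronglyMeasurable
  -- the exhausting compact sets
  set Kn : ℕ → Set (ℝ × EuclideanSpace ℝ (Fin 3)) := fun n =>
    Icc (-((n : ℝ) + 1)) (-((n : ℝ) + 1)⁻¹) ×ˢ closedBall 0 ((n : ℝ) + 1) with hKn_def
  have hKn_cpt : ∀ n, IsCompact (Kn n) := fun n => isCompact_Icc.prod (isCompact_closedBall _ _)
  have hKn_lt : ∀ n, Kn n ⊆ Iio (0 : ℝ) ×ˢ univ := by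
    intro n z hz
    refine ⟨?_, mem_univ _⟩
    have h1 : z.1 ≤ -((n : ℝ) + 1)⁻¹ := hz.1.2
    have h2 : (0 : ℝ) < ((n : ℝ) + 1)⁻¹ := by positivity
    exact lt_of_le_of_lt h1 (by linarith)
  have hKn_le : ∀ n, Kn n ⊆ Iic (0 : ℝ) ×ˢ univ := fun n =>
    (hKn_lt n).trans (prod_mono Iio_subset_Iic_self Subset.rfl)
  -- `u = 0` a.e. on each `Kn n`
  have hzero : ∀ n, ∀ᵐ z ∂(volume : Measure (ℝ × EuclideanSpace ℝ (Fin 3))),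
      z ∈ Kn n → uncurry u z = (0 : ℝ × EuclideanSpace ℝ (Fin 3) → EuclideanSpace ℝ (Fin 3)) z := by
    intro n
    have h0 := lintegral_enorm_rpow_three_eq_zero_of_recurrent hr hN hrec (hKn_cpt n) (hKn_le n)
    have hmn : AEMeasurable (fun z => ‖uncurry u z‖ₑ ^ (3 : ℝ)) (volume.restrict (Kn n)) :=
      (hmeas.mono_measure (Measure.restrict_mono (hKn_lt n) le_rfl)).enorm.pow_const _
    have hae := (lintegral_eq_zero_iff' hmn).1 h0
    rw [EventuallyEq, ae_restrict_iff' (hKn_cpt n).isClosed.measurableSet] at hae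
    filter_upwards [hae] with z hz hzK
    have h3 : ‖uncurry u z‖ₑ ^ (3 : ℝ) = 0 := hz hzK
    rw [ENNReal.rpow_eq_zero_iff_of_pos (by norm_num)] at h3
    simpa using h3
  have hall : ∀ᵐ z ∂(volume : Measure (ℝ × EuclideanSpace ℝ (Fin 3))), ∀ n, z ∈ Kn n →
      uncurry u z = (0 : ℝ × EuclideanSpace ℝ (Fin 3) → EuclideanSpace ℝ (Fin 3)) z :=
    ae_all_iff.2 hzero
  rw [EventuallyEq, ae_restrict_iff' (measurableSet_Iio.prod MeasurableSet.univ)]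
  filter_upwards [hall] with z hz hzmem
  -- `z` lies in some `Kn n`
  have ht : z.1 < 0 := hzmem.1
  have ht' : 0 < -z.1 := by linarith
  obtain ⟨n, hn⟩ := exists_nat_ge (max (-z.1) (max (-z.1)⁻¹ ‖z.2‖))
  have hn1 : -z.1 ≤ (n : ℝ) + 1 := by linarith [le_max_left (-z.1) (max (-z.1)⁻¹ ‖z.2‖)]
  have hn2 : (-z.1)⁻¹ ≤ (n : ℝ) + 1 := by
    linarith [le_max_left (-z.1)⁻¹ ‖z.2‖, le_max_right (-z.1) (max (-z.1)⁻¹ ‖z.2‖)]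
  have hn3 : ‖z.2‖ ≤ (n : ℝ) + 1 := by
    linarith [le_max_right (-z.1)⁻¹ ‖z.2‖, le_max_right (-z.1) (max (-z.1)⁻¹ ‖z.2‖)]
  refine hz n ⟨⟨by linarith, ?_⟩, ?_⟩
  · have : ((n : ℝ) + 1)⁻¹ ≤ -z.1 := (inv_le_comm₀ (by positivity) ht').2 hn2
    linarith
  · simpa using hn3

end Summit.NavierStokesRegularity.NavierStokesRegularity.Theorems
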